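import Literature.Computability.Complexity.SymmetricThresholdProgramsRefineIter
import Literature.Computability.Complexity.SymmetricThresholdProgramsSwitching
import Literature.Computability.Complexity.SymmetricThresholdProgramsReach
import Summits.PneNP.PneNP.Theorems.SymmetryBudgetNoHiddenOrderPerPathRefine
import Summits.PneNP.PneNP.Theorems.SymmetryBudgetNoHiddenOrderPerPathAtomsDefs

/-!
# `NoHiddenOrder` (stmt-PneNP-14781), (R2c) value layer III: three composite gadgets — definitions

Route `PneNP/SymmetryBudget`.  Composite gadgets of symmetric threshold programs (kit
`Literature/Computability/Complexity/SymmetricThresholdPrograms*.lean`) used at every stage of the decode walk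
and in the value module of the window canoniser:

* `Comps` — a `Switching` gadget and a `Reach` gadget wired together: from membership wires of a block `B`,
  adjacency wires and colour-kernel wires, the wires `R.r (Fin.last T) u w` read "`w ∈ swReach G B col u`"
  (the switching components, all base points at once);
* `ValOrd` — from one-hot VALUE wires `val v c` (`[f v = c]`, `c < D`) the order and kernel wires of `f`;
* `RefVal` — a `RefineIter` gadget on a block with an initial colouring, followed by COUNTING gates turning its
  final order into one-hot value wires of `BranchSum.refineIn` (a `refineIn` value is the number of block vertices
  below it: `val v c = [v ∈ A ∧ exactly c members w have ltW w v]`, and `[c = 0]` off the block).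
Semantics in `SymmetryBudgetNoHiddenOrderValueGadgets.lean`.  Definitions only; supports stmt-PneNP-14781.
-/

set_option linter.dupNamespace false -- `Summit.PneNP.PneNP.…` (D-0017 single-conjunct layout)

namespace Summit.PneNP.PneNP.Theorems

open Finset Literature.Computability.Complexity Literature.Computability.Complexity.SymProg

variable {ι Λ : Type*} [DecidableEq ι] [DecidableEq Λ] (P : SymProg ι Λ)
variable (V : Type*) [Fintype V] [DecidableEq V] (N T D : ℕ)

/-- **Switching components**: a switching gadget and a reachability gadget on its output. [folklore] -/
structure Comps where
  /-- the switching gadget on the block -/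
  S : P.Switching V N
  /-- the reachability gadget on the switching edges -/
  R : P.Reach V T
  /-- it reads the same membership -/
  R_mem : ∀ u, R.mem u = S.mem u
  /-- its edges are the switching edges -/
  R_edge : ∀ a b, R.edge a b = Sum.inr (S.sw a b)

/-- **Order and kernel from one-hot values**: `pr u v c c' = val u c ∧ val v c'`, `lt u v = ∃ c < c', pr u v c c'`,
`eq u v = ∃ c, pr u v c c`. [folklore] -/
structure ValOrd where
  /-- the value wires: `val v c = [f v = c]` -/
  val : V → Fin D → ι ⊕ Λ
  /-- pair gates -/
  pr : V → V → Fin D → Fin D → Λ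
  /-- OUTPUT: order -/
  lt : V → V → Λ
  /-- OUTPUT: kernel -/
  eq : V → V → Λ
  kind_pr : ∀ u v c c', P.kind (pr u v c c') = Kind.and
  srcs_pr : ∀ u v c c', P.srcs (pr u v c c') = {val u c, val v c'}
  kind_lt : ∀ u v, P.kind (lt u v) = Kind.or
  srcs_lt : ∀ u v, P.srcs (lt u v) =
    ((univ : Finset (Fin D × Fin D)).filter fun cc => cc.1 < cc.2).image fun cc => Sum.inr (pr u v cc.1 cc.2)
  kind_eq : ∀ u v, P.kind (eq u v) = Kind.or
  srcs_eq : ∀ u v, P.srcs (eq u v) = (univ : Finset (Fin D)).image fun c => Sum.inr (pr u v c c)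

/-- **Refinement with value read-out**: `T` rounds of ordered refinement of an initial colouring inside a block
(`RI`), then `c w v = [w ∈ A ∧ ltW_T w v]`, `ge v t = [#{w | c w v} ≥ t]`, `nge`, `inA v t = mem v ∧ ge v t ∧ ¬ge v (t+1)`,
`nm v = ¬mem v`, and the OUTPUT value wires `val v t` (`inA v t`, or-ed with `nm v` for `t = 0`). [folklore] -/
structure RefVal where
  /-- the refinement module -/
  RI : P.RefineIter V N T
  /-- `c w v`: `w` is a member below `v` in the final order -/
  c : V → V → Λ
  /-- `ge v t`: at least `t` members below `v` -/
  ge : V → Fin (D + 1) → Λ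
  /-- `nge v t = ¬ ge v t` -/
  nge : V → Fin (D + 1) → Λ
  /-- `inA v t`: `v` is a member with exactly `t` members below -/
  inA : V → Fin D → Λ
  /-- `nm v = ¬ mem v` -/
  nm : V → Λ
  /-- OUTPUT: `val v t = [refineIn … v = t]` -/
  val : V → Fin D → Λ
  c_injective : ∀ v, Function.Injective fun w => c w v
  kind_c : ∀ w v, P.kind (c w v) = Kind.and
  srcs_c : ∀ w v, P.srcs (c w v) = {RI.mem w, RI.ltW (Fin.last T) w v}
  kind_ge : ∀ v t, P.kind (ge v t) = Kind.atLeast t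
  srcs_ge : ∀ v t, P.srcs (ge v t) = univ.image fun w => Sum.inr (c w v)
  kind_nge : ∀ v t, P.kind (nge v t) = Kind.nor
  srcs_nge : ∀ v t, P.srcs (nge v t) = {Sum.inr (ge v t)}
  kind_inA : ∀ v t, P.kind (inA v t) = Kind.and
  srcs_inA : ∀ v t, P.srcs (inA v t) = {RI.mem v, Sum.inr (ge v t.castSucc), Sum.inr (nge v t.succ)}
  kind_nm : ∀ v, P.kind (nm v) = Kind.nor
  srcs_nm : ∀ v, P.srcs (nm v) = {RI.mem v}
  kind_val : ∀ v t, P.kind (val v t) = Kind.or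
  srcs_val : ∀ v t, P.srcs (val v t) = if (t : ℕ) = 0 then {Sum.inr (inA v t), Sum.inr (nm v)} else {Sum.inr (inA v t)}

end Summit.PneNP.PneNP.Theorems
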